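import Summits.QuantumFields.YangMills.Theorems.BalabanUVNodesN18KingModelScales

/-!
# BalabanUVNodes ∕ N18 — VERTEX-GRAPH BRACKETS (generic, any carriers): three-factor read-outs whose rows and columns READ the
# couplings `g` and the background `U` carry (0.25) and `NE5`, and — when the rows ∕ columns are Lipschitz in the carriers'
# gauge ∕ in the coupling history — the brackets `LipBackground` and `NE9` with moduli = (one-run envelope constant) × (vertex
# modulus) (Track A, DAG node N18 = NE5 `T4OutputRate.NE5 EA EB W κ θ C₅` :211; director-ym R134 row n18 s3 «King-model transfer
# `N18KingModelTorus` (κ, C₅ from (d, L, a, m², γ)) → `TwoRunTorusNE5Final*`», module 6a of seat pub-ymgap-dag-n18-e; module 6b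
# `N18KingModelVertices` instantiates it on King's ACTUAL operators with vertex functions)

HONEST FRAMING.  Count-neutral kernel bookkeeping (seat pub-ymgap-dag-n18-e g5, strategy s3; `--supports` K3′
`SpineGivenEndpointR12`, helper).  Elementary real analysis (exponential convolutions through positions, `N18KingModelScales.
bilin_decay_bound` ∕ `bilin3_rate`) around the cell's hypothesis SHAPES `T4OutputRate.DecayBound ∕ NE5 ∕ LipBackground ∕ NE9 ∕
FadingMemory`; every row, kernel, column, rate and modulus is a HYPOTHESIS.  NOT Bałaban's covariant one-step outputs
`E^{(j)}(X; g, U_k(V))` of [Balaban1987RG1] (0.24)∕(2.13), for which NE5 ∕ NE9 are NOT IN PRINT and have no tree producer (NODE O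
instance 0∕1); NOT a node discharge; nothing continuum ∕ ℝ⁴ ∕ OS ∕ mass-gap ∕ Clay.  THEOREMS ONLY: 0 `def`, 0 `sorry`,
standard axioms.

THE POINT.  `N18KingModelScales.ne5_of_threeFactorRates` (p415038) and 5a `N18KingModelOneRun.decayBound_of_threeFactorDecay`
(p477039) knit (3.73)'s mechanism for three-factor read-outs `u(X) ⬝ (E(X) v(X))` whose rows and columns do NOT read `(g, U)` —
whence the ZERO Lipschitz ∕ history letters of 5a `kingModel_threeFactor_allShapes_torus` (p418046 NOT-COVERED «vertex functions
at z, w»; referee dag-ref-F READ-64 GAP-STATED «no vertex functions»; the seat's census (i) «U-reading rung NOT TYPABLE at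
A = 0»).  THIS FILE threads `(g, U)` through the rows and columns — `F g U X = u(g,U,X) ⬝ (E(X) v(g,U,X))`, run A read at the
TRANSPORTED background where NE5 compares — and derives ALL FOUR brackets of node U3 from factor data:
* `dot_mulVec_sub_split` — `u⬝(Ev) − u′⬝(Ev′) = (u − u′)⬝(Ev) + u′⬝(E(v − v′))`;
* `decayBound_of_vertexGraph` — (0.25): envelopes of `u, E, v` uniform in `(g, U)` ⟹ `DecayBound F W (acbV²) (κ∕2)`;
* `ne5_of_vertexGraphRates` — NE5: one-line rates `∝ θ^{scale X}` between run B's lines and run A's transported lines ⟹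
  `NE5 EA EB W (κ∕2) θ ((c_A cb + a c_C b + ac c_B)V²)`;
* **`lipBackground_of_vertexGraph`** — rows ∕ columns `ℓ_u, ℓ_v`-Lipschitz in the carriers' gauge relative to their envelopes ⟹
  `LipBackground F W (κ∕2) (fun _ _ => (ℓ_u + ℓ_v)·acbV²)` ([III] (2.27)(ii)'s `C_U ∝ E₀∕α`: here `E₀·ℓ`, scale-free);
* **`ne9_of_vertexGraph`** — rows ∕ columns Lipschitz in the coupling history on the window with moduli `Λ_u, Λ_v` ⟹
  `NE9 F W (κ∕2) (fun k i => (Λ_u k i + Λ_v k i)·acbV²)`; `fadingMemory_add_mul` — fading memory of the combined moduli.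
So a King-type graph with BACKGROUND- and HISTORY-DEPENDENT vertex insertions inhabits every `T4OutputRate` §2 shape with
NON-ZERO letters, and the U3 three brackets (`T4OutputRate.u3_threeBrackets`) fire with no bracket idle (module 6b).
WHAT THIS DOES NOT DO.  No operator of King's or Bałaban's appears here (module 6b supplies King's); the insertions' Lipschitz
moduli are data, not derived from an analyticity domain (the Cauchy step of [III] (2.27)–(2.28) is NOT carried out).

Sources: C. King, Commun. Math. Phys. **102** (1986) 649–677 [King1986] — (4.41)–(4.43) p. 675, Prop. 3.9 (3.73) p. 665; T. Bałaban,
Commun. Math. Phys. **109** (1987) 249–301 [Balaban1987RG1] — (0.25) p. 257, (1.18) p. 263, §1 p. 263, §5 p. 298; **119** (1988)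
243–285 [Balaban1988Convergent] (2.27)(ii)–(2.28) p. 259.  No claim about the mass gap.
-/

noncomputable section

namespace Summit.QuantumFields.YangMills.BalabanUVNodes.N18VertexGraphBrackets

open Real Matrix
open Literature.MathematicalPhysics.QuantumFieldTheory.Balaban1983to89
open Literature.MathematicalPhysics.QuantumFieldTheory.Balaban1983to89.T4OutputRate
  (Carriers Functional NE5 DecayBound NE9 LipBackground FadingMemory)
open Summit.QuantumFields.YangMills.BalabanUVNodes.N18KingModelScales (bilin_decay_bound bilin3_rate)

/-! ## (g, U)-threaded three-factor read-outs: (0.25), `NE5`, and the two Lipschitz brackets -/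

section Generic

variable {C : Carriers} {β : ℕ → Type*} [∀ j, Fintype (β j)] {P : ℕ → Type*}

/-- The two-term replacement identity at a fixed middle kernel: `u⬝(Ev) − u′⬝(Ev′) = (u − u′)⬝(Ev) + u′⬝(E(v − v′))`.
[cite: King1986, (4.42)–(4.43) p.675] -/
theorem dot_mulVec_sub_split {n : Type*} [Fintype n] (u u' v v' : n → ℝ) (E : Matrix n n ℝ) :
    u ⬝ᵥ (E *ᵥ v) - u' ⬝ᵥ (E *ᵥ v') = (u - u') ⬝ᵥ (E *ᵥ v) + u' ⬝ᵥ (E *ᵥ (v - v')) := by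
  simp only [sub_dotProduct, Matrix.mulVec_sub, dotProduct_sub]
  ring

/-- **(0.25) FOR A (g, U)-DEPENDENT THREE-FACTOR READ-OUT** (5a `decayBound_of_threeFactorDecay` with rows and columns
reading the couplings and the background): `F g U X = u(g,U,X) ⬝ (E(X) v(g,U,X))` with `|u| ≤ a e^{−κρ(p X, q z)}`,
`|E| ≤ c e^{−κρ}`, `|v| ≤ b e^{−κρ(q w, r X)}` UNIFORMLY in `(g, U)`, lattice sums `V`, `d X ≤ ρ(p X, r X)` ⟹
`DecayBound F W (a·c·b·V²) (κ∕2)`. [cite: King1986, (4.41) p.675; Balaban1987RG1, (0.25) p.257] -/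
theorem decayBound_of_vertexGraph (ρ : (j : ℕ) → P j → P j → ℝ) (hρ0 : ∀ j p q, 0 ≤ ρ j p q)
    (hρtri : ∀ j p q r, ρ j p r ≤ ρ j p q + ρ j q r) (q : (j : ℕ) → β j → P j)
    (p r : (X : C.Dom) → P (C.scale X)) {Bg : Type}
    (u v : (ℕ → ℝ) → Bg → (X : C.Dom) → β (C.scale X) → ℝ)
    (E : (X : C.Dom) → Matrix (β (C.scale X)) (β (C.scale X)) ℝ)
    {κ a c b V : ℝ} (hκ : 0 ≤ κ) (ha : 0 ≤ a) (hc : 0 ≤ c) (hb : 0 ≤ b)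
    (hu : ∀ g U X z, |u g U X z| ≤ a * Real.exp (-(κ * ρ _ (p X) (q _ z))))
    (hE : ∀ X z w, |E X z w| ≤ c * Real.exp (-(κ * ρ _ (q _ z) (q _ w))))
    (hv : ∀ g U X w, |v g U X w| ≤ b * Real.exp (-(κ * ρ _ (q _ w) (r X))))
    (hV : ∀ j (s : P j), ∑ z, Real.exp (-(κ / 2 * ρ j s (q j z))) ≤ V)
    (hd : ∀ X, C.d X ≤ ρ _ (p X) (r X))
    (F : Functional C Bg) (hF : ∀ g U X, F g U X = u g U X ⬝ᵥ (E X *ᵥ v g U X)) (W : Set (ℕ → ℝ)) :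
    DecayBound F W (a * c * b * V ^ 2) (κ / 2) := by
  intro g _ U X
  rw [hF]
  have h := bilin_decay_bound (ρ (C.scale X)) (hρ0 _) (hρtri _) (q _) (p X) (r X) (u g U X) (v g U X) (E X) hκ
    ha hc hb (hu g U X) (hE X) (hv g U X) (hV _)
  refine h.trans ?_
  have hV0 : 0 ≤ V := (Finset.sum_nonneg fun z _ => (Real.exp_pos _).le).trans (hV _ (p X))
  have hK : 0 ≤ a * c * b * V ^ 2 := by positivity
  exact mul_le_mul_of_nonneg_left
    (Real.exp_le_exp.mpr (neg_le_neg (mul_le_mul_of_nonneg_left (hd X) (by positivity)))) hK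

/-- **`NE5` FOR (g, U)-DEPENDENT THREE-FACTOR READ-OUTS** ((g, U)-threaded twin of `N18KingModelScales.ne5_of_threeFactorRates`):
run A's rows ∕ columns are read AT THE TRANSPORTED background `C.transport U` (where NE5 compares), run B's at `U`; sizes
`a, c, c, b`, one-line rates `cA·θ^j`, `cC·θ^j`, `cB·θ^j` between run B's lines and run A's transported lines, common decay `κ`,
lattice sums `V` ⟹ `NE5 EA EB W (κ∕2) θ ((cA·c·b + a·cC·b + a·c·cB)·V²)`. [cite: King1986, Prop. 3.9 (3.73) p.665, (4.42)–(4.43) p.675] -/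
theorem ne5_of_vertexGraphRates (ρ : (j : ℕ) → P j → P j → ℝ) (hρ0 : ∀ j p q, 0 ≤ ρ j p q)
    (hρtri : ∀ j p q r, ρ j p r ≤ ρ j p q + ρ j q r) (q : (j : ℕ) → β j → P j)
    (p r : (X : C.Dom) → P (C.scale X))
    (uA vA : (ℕ → ℝ) → C.BgA → (X : C.Dom) → β (C.scale X) → ℝ)
    (uB vB : (ℕ → ℝ) → C.BgB → (X : C.Dom) → β (C.scale X) → ℝ)
    (CA CB : (X : C.Dom) → Matrix (β (C.scale X)) (β (C.scale X)) ℝ)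
    {κ θ a c b cA cC cB V : ℝ} (hκ : 0 ≤ κ) (hθ : 0 ≤ θ) (ha : 0 ≤ a) (hc : 0 ≤ c) (hb : 0 ≤ b)
    (hcA : 0 ≤ cA) (hcC : 0 ≤ cC) (hcB : 0 ≤ cB)
    (hu : ∀ g U X z, |uA g (C.transport U) X z| ≤ a * Real.exp (-(κ * ρ _ (p X) (q _ z))))
    (hCA : ∀ X z w, |CA X z w| ≤ c * Real.exp (-(κ * ρ _ (q _ z) (q _ w))))
    (hCB : ∀ X z w, |CB X z w| ≤ c * Real.exp (-(κ * ρ _ (q _ z) (q _ w))))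
    (hv : ∀ g U X w, |vB g U X w| ≤ b * Real.exp (-(κ * ρ _ (q _ w) (r X))))
    (hdu : ∀ g U X z, |uB g U X z - uA g (C.transport U) X z|
      ≤ cA * θ ^ C.scale X * Real.exp (-(κ * ρ _ (p X) (q _ z))))
    (hdC : ∀ X z w, |CB X z w - CA X z w| ≤ cC * θ ^ C.scale X * Real.exp (-(κ * ρ _ (q _ z) (q _ w))))
    (hdv : ∀ g U X w, |vB g U X w - vA g (C.transport U) X w|
      ≤ cB * θ ^ C.scale X * Real.exp (-(κ * ρ _ (q _ w) (r X))))
    (hV : ∀ j (s : P j), ∑ z, Real.exp (-(κ / 2 * ρ j s (q j z))) ≤ V)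
    (hd : ∀ X, C.d X ≤ ρ _ (p X) (r X))
    {EA : Functional C C.BgA} {EB : Functional C C.BgB}
    (hEA : ∀ g U X, EA g U X = uA g U X ⬝ᵥ (CA X *ᵥ vA g U X))
    (hEB : ∀ g U X, EB g U X = uB g U X ⬝ᵥ (CB X *ᵥ vB g U X)) (W : Set (ℕ → ℝ)) :
    NE5 EA EB W (κ / 2) θ ((cA * c * b + a * cC * b + a * c * cB) * V ^ 2) := by
  intro g _ U X
  rw [hEA, hEB, abs_sub_comm]
  have hθj : 0 ≤ θ ^ C.scale X := pow_nonneg hθ _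
  have h := bilin3_rate (ρ (C.scale X)) (hρ0 _) (hρtri _) (q _) (p X) (r X) (uA g (C.transport U) X) (uB g U X)
    (vA g (C.transport U) X) (vB g U X) (CA X) (CB X) hκ ha hc hb (mul_nonneg hcA hθj) (mul_nonneg hcC hθj)
    (mul_nonneg hcB hθj) (hu g U X) (hCA X) (hCB X) (hv g U X) (hdu g U X) (hdC X) (hdv g U X) (hV _)
  refine h.trans ?_
  have hV0 : 0 ≤ V := (Finset.sum_nonneg fun z _ => (Real.exp_pos _).le).trans (hV _ (p X))
  have hK : 0 ≤ (cA * c * b + a * cC * b + a * c * cB) * V ^ 2 * θ ^ C.scale X := by positivity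
  have hexp : Real.exp (-(κ / 2 * ρ _ (p X) (r X))) ≤ Real.exp (-(κ / 2 * C.d X)) :=
    Real.exp_le_exp.mpr (neg_le_neg (mul_le_mul_of_nonneg_left (hd X) (by positivity)))
  calc (cA * θ ^ C.scale X * c * b + a * (cC * θ ^ C.scale X) * b + a * c * (cB * θ ^ C.scale X)) * V ^ 2
          * Real.exp (-(κ / 2 * ρ _ (p X) (r X)))
      = (cA * c * b + a * cC * b + a * c * cB) * V ^ 2 * θ ^ C.scale X
          * Real.exp (-(κ / 2 * ρ _ (p X) (r X))) := by ring
    _ ≤ (cA * c * b + a * cC * b + a * c * cB) * V ^ 2 * θ ^ C.scale X * Real.exp (-(κ / 2 * C.d X)) :=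
        mul_le_mul_of_nonneg_left hexp hK

/-- **THE BACKGROUND-LIPSCHITZ BRACKET FROM LIPSCHITZ VERTICES** ([III] (2.27)(ii)'s shape `T4OutputRate.LipBackground`).  If
the rows and columns of a three-factor read-out are Lipschitz in the background THROUGH THE CARRIERS' GAUGE, relative to their
own envelopes — `|u(g,U,X) − u(g,U′,X)|_z ≤ ℓ_u·gauge(U,U′)·a e^{−κρ}`, `|v(g,U,X) − v(g,U′,X)|_w ≤ ℓ_v·gauge(U,U′)·b e^{−κρ}` — then
`LipBackground F W (κ∕2) (fun _ _ => (ℓ_u + ℓ_v)·(a·c·b·V²))`: the background-Lipschitz modulus is the ONE-RUN ENVELOPE CONSTANT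
times the vertex modulus, scale-free. [cite: Balaban1988Convergent, (2.27) p.259; King1986, (4.41)–(4.43) p.675] -/
theorem lipBackground_of_vertexGraph (ρ : (j : ℕ) → P j → P j → ℝ) (hρ0 : ∀ j p q, 0 ≤ ρ j p q)
    (hρtri : ∀ j p q r, ρ j p r ≤ ρ j p q + ρ j q r) (q : (j : ℕ) → β j → P j)
    (p r : (X : C.Dom) → P (C.scale X))
    (u v : (ℕ → ℝ) → C.BgA → (X : C.Dom) → β (C.scale X) → ℝ)
    (E : (X : C.Dom) → Matrix (β (C.scale X)) (β (C.scale X)) ℝ)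
    {κ a c b V ℓu ℓv : ℝ} (hκ : 0 ≤ κ) (ha : 0 ≤ a) (hc : 0 ≤ c) (hb : 0 ≤ b) (hℓu : 0 ≤ ℓu) (hℓv : 0 ≤ ℓv)
    (hu : ∀ g U X z, |u g U X z| ≤ a * Real.exp (-(κ * ρ _ (p X) (q _ z))))
    (hE : ∀ X z w, |E X z w| ≤ c * Real.exp (-(κ * ρ _ (q _ z) (q _ w))))
    (hv : ∀ g U X w, |v g U X w| ≤ b * Real.exp (-(κ * ρ _ (q _ w) (r X))))
    (hdu : ∀ g U U' X z, |u g U X z - u g U' X z| ≤ ℓu * C.gauge U U' * a * Real.exp (-(κ * ρ _ (p X) (q _ z))))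
    (hdv : ∀ g U U' X w, |v g U X w - v g U' X w| ≤ ℓv * C.gauge U U' * b * Real.exp (-(κ * ρ _ (q _ w) (r X))))
    (hV : ∀ j (s : P j), ∑ z, Real.exp (-(κ / 2 * ρ j s (q j z))) ≤ V)
    (hd : ∀ X, C.d X ≤ ρ _ (p X) (r X))
    (F : Functional C C.BgA) (hF : ∀ g U X, F g U X = u g U X ⬝ᵥ (E X *ᵥ v g U X)) (W : Set (ℕ → ℝ)) :
    LipBackground F W (κ / 2) (fun _ _ => (ℓu + ℓv) * (a * c * b * V ^ 2)) := by
  intro g _ U U' X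
  rw [hF, hF, dot_mulVec_sub_split]
  have hG : 0 ≤ C.gauge U U' := C.gauge_nonneg U U'
  have h1 := bilin_decay_bound (ρ (C.scale X)) (hρ0 _) (hρtri _) (q _) (p X) (r X) (u g U X - u g U' X) (v g U X) (E X)
    hκ (by positivity : 0 ≤ ℓu * C.gauge U U' * a) hc hb (fun z => by rw [Pi.sub_apply]; exact hdu g U U' X z) (hE X)
    (hv g U X) (hV _)
  have h2 := bilin_decay_bound (ρ (C.scale X)) (hρ0 _) (hρtri _) (q _) (p X) (r X) (u g U' X) (v g U X - v g U' X) (E X)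
    hκ ha hc (by positivity : 0 ≤ ℓv * C.gauge U U' * b) (hu g U' X) (hE X)
    (fun w => by rw [Pi.sub_apply]; exact hdv g U U' X w) (hV _)
  have hV0 : 0 ≤ V := (Finset.sum_nonneg fun z _ => (Real.exp_pos _).le).trans (hV _ (p X))
  have hK : 0 ≤ (ℓu + ℓv) * (a * c * b * V ^ 2) * C.gauge U U' := by positivity
  have hexp : Real.exp (-(κ / 2 * ρ _ (p X) (r X))) ≤ Real.exp (-(κ / 2 * C.d X)) :=
    Real.exp_le_exp.mpr (neg_le_neg (mul_le_mul_of_nonneg_left (hd X) (by positivity)))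
  calc |(u g U X - u g U' X) ⬝ᵥ (E X *ᵥ v g U X) + u g U' X ⬝ᵥ (E X *ᵥ (v g U X - v g U' X))|
      ≤ |(u g U X - u g U' X) ⬝ᵥ (E X *ᵥ v g U X)| + |u g U' X ⬝ᵥ (E X *ᵥ (v g U X - v g U' X))| := abs_add_le _ _
    _ ≤ ℓu * C.gauge U U' * a * c * b * V ^ 2 * Real.exp (-(κ / 2 * ρ _ (p X) (r X)))
        + a * c * (ℓv * C.gauge U U' * b) * V ^ 2 * Real.exp (-(κ / 2 * ρ _ (p X) (r X))) := add_le_add h1 h2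
    _ = (ℓu + ℓv) * (a * c * b * V ^ 2) * C.gauge U U' * Real.exp (-(κ / 2 * ρ _ (p X) (r X))) := by ring
    _ ≤ (ℓu + ℓv) * (a * c * b * V ^ 2) * C.gauge U U' * Real.exp (-(κ / 2 * C.d X)) :=
        mul_le_mul_of_nonneg_left hexp hK
    _ = (ℓu + ℓv) * (a * c * b * V ^ 2) * Real.exp (-(κ / 2 * C.d X)) * C.gauge U U' := by ring

/-- **THE HISTORY BRACKET `NE9` FROM HISTORY-LIPSCHITZ VERTICES** (the cell's unprinted `T4OutputRate.NE9` shape).  If the rows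
and columns are Lipschitz in the coupling HISTORY on the window, relative to their envelopes, with moduli `Λ_u, Λ_v` —
`|u(g,U,X) − u(g′,U,X)|_z ≤ (Σ_{i<j} Λ_u(j,i)|g_i − g′_i|)·a e^{−κρ}` (`j = scale X`), likewise `v` — then
`NE9 F W (κ∕2) (fun k i => (Λ_u k i + Λ_v k i)·(a·c·b·V²))`. [cite: Balaban1987RG1, §1 p.263 and §5 p.298; King1986, (4.41)–(4.43) p.675] -/
theorem ne9_of_vertexGraph (ρ : (j : ℕ) → P j → P j → ℝ) (hρ0 : ∀ j p q, 0 ≤ ρ j p q)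
    (hρtri : ∀ j p q r, ρ j p r ≤ ρ j p q + ρ j q r) (q : (j : ℕ) → β j → P j)
    (p r : (X : C.Dom) → P (C.scale X)) {Bg : Type}
    (u v : (ℕ → ℝ) → Bg → (X : C.Dom) → β (C.scale X) → ℝ)
    (E : (X : C.Dom) → Matrix (β (C.scale X)) (β (C.scale X)) ℝ)
    {κ a c b V : ℝ} {Λu Λv : ℕ → ℕ → ℝ} (hκ : 0 ≤ κ) (ha : 0 ≤ a) (hc : 0 ≤ c) (hb : 0 ≤ b)
    (hΛu : ∀ k i, 0 ≤ Λu k i) (hΛv : ∀ k i, 0 ≤ Λv k i) {W : Set (ℕ → ℝ)}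
    (hu : ∀ g U X z, |u g U X z| ≤ a * Real.exp (-(κ * ρ _ (p X) (q _ z))))
    (hE : ∀ X z w, |E X z w| ≤ c * Real.exp (-(κ * ρ _ (q _ z) (q _ w))))
    (hv : ∀ g U X w, |v g U X w| ≤ b * Real.exp (-(κ * ρ _ (q _ w) (r X))))
    (hdu : ∀ g ∈ W, ∀ g' ∈ W, ∀ U X z, |u g U X z - u g' U X z|
      ≤ (∑ i ∈ Finset.range (C.scale X), Λu (C.scale X) i * |g i - g' i|) * a
        * Real.exp (-(κ * ρ _ (p X) (q _ z))))
    (hdv : ∀ g ∈ W, ∀ g' ∈ W, ∀ U X w, |v g U X w - v g' U X w|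
      ≤ (∑ i ∈ Finset.range (C.scale X), Λv (C.scale X) i * |g i - g' i|) * b
        * Real.exp (-(κ * ρ _ (q _ w) (r X))))
    (hV : ∀ j (s : P j), ∑ z, Real.exp (-(κ / 2 * ρ j s (q j z))) ≤ V)
    (hd : ∀ X, C.d X ≤ ρ _ (p X) (r X))
    (F : Functional C Bg) (hF : ∀ g U X, F g U X = u g U X ⬝ᵥ (E X *ᵥ v g U X)) :
    NE9 F W (κ / 2) (fun k i => (Λu k i + Λv k i) * (a * c * b * V ^ 2)) := by
  intro g hg g' hg' U X
  rw [hF, hF, dot_mulVec_sub_split]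
  set Su : ℝ := ∑ i ∈ Finset.range (C.scale X), Λu (C.scale X) i * |g i - g' i| with hSu
  set Sv : ℝ := ∑ i ∈ Finset.range (C.scale X), Λv (C.scale X) i * |g i - g' i| with hSv
  have hSu0 : 0 ≤ Su := Finset.sum_nonneg fun i _ => mul_nonneg (hΛu _ _) (abs_nonneg _)
  have hSv0 : 0 ≤ Sv := Finset.sum_nonneg fun i _ => mul_nonneg (hΛv _ _) (abs_nonneg _)
  have h1 := bilin_decay_bound (ρ (C.scale X)) (hρ0 _) (hρtri _) (q _) (p X) (r X) (u g U X - u g' U X) (v g U X) (E X)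
    hκ (by positivity : 0 ≤ Su * a) hc hb (fun z => by rw [Pi.sub_apply]; exact hdu g hg g' hg' U X z) (hE X)
    (hv g U X) (hV _)
  have h2 := bilin_decay_bound (ρ (C.scale X)) (hρ0 _) (hρtri _) (q _) (p X) (r X) (u g' U X) (v g U X - v g' U X) (E X)
    hκ ha hc (by positivity : 0 ≤ Sv * b) (hu g' U X) (hE X)
    (fun w => by rw [Pi.sub_apply]; exact hdv g hg g' hg' U X w) (hV _)
  have hV0 : 0 ≤ V := (Finset.sum_nonneg fun z _ => (Real.exp_pos _).le).trans (hV _ (p X))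
  have hK : 0 ≤ (Su + Sv) * (a * c * b * V ^ 2) := by positivity
  have hexp : Real.exp (-(κ / 2 * ρ _ (p X) (r X))) ≤ Real.exp (-(κ / 2 * C.d X)) :=
    Real.exp_le_exp.mpr (neg_le_neg (mul_le_mul_of_nonneg_left (hd X) (by positivity)))
  have hsum : ∑ i ∈ Finset.range (C.scale X), (Λu (C.scale X) i + Λv (C.scale X) i) * (a * c * b * V ^ 2) * |g i - g' i|
      = (Su + Sv) * (a * c * b * V ^ 2) := by
    rw [hSu, hSv, ← Finset.sum_add_distrib, Finset.sum_mul]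
    exact Finset.sum_congr rfl fun i _ => by ring
  rw [hsum]
  calc |(u g U X - u g' U X) ⬝ᵥ (E X *ᵥ v g U X) + u g' U X ⬝ᵥ (E X *ᵥ (v g U X - v g' U X))|
      ≤ |(u g U X - u g' U X) ⬝ᵥ (E X *ᵥ v g U X)| + |u g' U X ⬝ᵥ (E X *ᵥ (v g U X - v g' U X))| := abs_add_le _ _
    _ ≤ Su * a * c * b * V ^ 2 * Real.exp (-(κ / 2 * ρ _ (p X) (r X)))
        + a * c * (Sv * b) * V ^ 2 * Real.exp (-(κ / 2 * ρ _ (p X) (r X))) := add_le_add h1 h2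
    _ = (Su + Sv) * (a * c * b * V ^ 2) * Real.exp (-(κ / 2 * ρ _ (p X) (r X))) := by ring
    _ ≤ (Su + Sv) * (a * c * b * V ^ 2) * Real.exp (-(κ / 2 * C.d X)) := mul_le_mul_of_nonneg_left hexp hK
    _ = Real.exp (-(κ / 2 * C.d X)) * ((Su + Sv) * (a * c * b * V ^ 2)) := by ring

/-- Fading memory of the combined moduli: `Λ_u ≤ C_u ω^{k−i}`, `Λ_v ≤ C_v ω^{k−i}` ⟹ `(Λ_u + Λ_v)·B ≤ (C_u + C_v)B·ω^{k−i}` (`B ≥ 0`).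
[cite: Balaban1987RG1, §5 p.298] -/
theorem fadingMemory_add_mul {Cu Cv ω B : ℝ} {Λu Λv : ℕ → ℕ → ℝ} (hB : 0 ≤ B)
    (hu : FadingMemory Cu ω Λu) (hv : FadingMemory Cv ω Λv) :
    FadingMemory ((Cu + Cv) * B) ω (fun k i => (Λu k i + Λv k i) * B) := by
  intro k i hik
  obtain ⟨hu0, hu1⟩ := hu k i hik
  obtain ⟨hv0, hv1⟩ := hv k i hik
  refine ⟨mul_nonneg (add_nonneg hu0 hv0) hB, ?_⟩
  calc (Λu k i + Λv k i) * B ≤ (Cu * ω ^ (k - i) + Cv * ω ^ (k - i)) * B :=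
        mul_le_mul_of_nonneg_right (add_le_add hu1 hv1) hB
    _ = (Cu + Cv) * B * ω ^ (k - i) := by ring

end Generic

end Summit.QuantumFields.YangMills.BalabanUVNodes.N18VertexGraphBrackets

end
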